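import Summits.Ventures.PercRepro.ProfilePointedCircuitClassesCoreLYM
import Summits.Ventures.PercRepro.ProfilePointedCircuitClassesOne

/-!
# PercRepro — THE CO-RANK-5 TOP THRESHOLD AT NULLITY 4: THE REMAINING CLASSES AND THE ASSEMBLY
(p5, gen 36; `proofs/P5-GM1.md` §52)

With the per-circuit split `capCount_eq_sum_gammaC` and the classes `#C ≥ 3` of `ProfilePointedCircuitClasses`, the
local LYM of the core class `#C = 2` (`ProfilePointedCircuitClassesCoreLYM`) and the class `#C = 1`
(`ProfilePointedCircuitClassesOne`), this module closes the remaining classes — `#C = 2` by the LYM counting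
`card_le_card_of_lym` on the containment graph of the class, `#C = 0` (a captured set has a non-empty fundamental
circuit) — and assembles: `κ_4(x) ≤ κ_{n−5}(x)` on every matroid of nullity `4` and rank `≥ 6`, hence
`out_4(x) ≤ in_5(x)` by the mirror identity, hence THEOREM A'S STEP AT THE LEVEL `4` (`biIndep_step_four_of_nullity_four`)
and THE CO-RANK-5 TOP THRESHOLD ON EVERY MATROID WITH `#E ≤ ρ(E) + 4` AND `ρ(E) ≥ 5`
(`thresholdIneq_five_top_of_nullity_le_four`), UNCONDITIONALLY — the unconditional form of
`thresholdIneq_five_top_of_nullity_le_four_of_unimodal` (OPEN (2)'s nullity-4 sub-case, §52).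
-/

open scoped Matroid

namespace PercRepro.Cogirth

open Finset ThmH Skew Shadow Profile

variable {α : Type} [DecidableEq α] {N : Matroid α} [N.Finite]

section Assembly

/-- **THE LYM COUNTING ON A BIPARTITE CONTAINMENT GRAPH**: if every source `W ∈ D` lies below some target of `U`
and, on every edge `W ⊆ V`, the number of sources below `V` is at most the number of targets above `W`, then
`#D ≤ #U` — the weight `1／s(W)` on the edges above `W` (`s(W)` targets above `W`) sends exactly `1` from each
source and loads each target `V` with `Σ_{W ⊆ V} 1／s(W) ≤ c(V)·(1／c(V)) ≤ 1`. -/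
theorem card_le_card_of_lym (D U : Finset (Finset α))
    (hsup : ∀ W ∈ D, ∃ V ∈ U, W ⊆ V)
    (hlym : ∀ W ∈ D, ∀ V ∈ U, W ⊆ V →
      (D.filter (fun W' => W' ⊆ V)).card ≤ (U.filter (fun V' => W ⊆ V')).card) :
    D.card ≤ U.card := by
  -- work in `ℚ`
  have key : (D.card : ℚ) ≤ U.card := by
    have h1 : (D.card : ℚ) = ∑ W ∈ D, ∑ V ∈ U.filter (fun V' => W ⊆ V'),
        (1 / ((U.filter (fun V' => W ⊆ V')).card : ℚ)) := by
      rw [card_eq_sum_ones, Nat.cast_sum]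
      apply sum_congr rfl
      intro W hW
      rw [sum_const, nsmul_eq_mul]
      obtain ⟨V, hV, hWV⟩ := hsup W hW
      have hpos : 0 < (U.filter (fun V' => W ⊆ V')).card := card_pos.2 ⟨V, mem_filter.2 ⟨hV, hWV⟩⟩
      have hne : ((U.filter (fun V' => W ⊆ V')).card : ℚ) ≠ 0 := by exact_mod_cast hpos.ne'
      rw [Nat.cast_one, mul_one_div, div_self hne]
    have h2 : ∑ W ∈ D, ∑ V ∈ U.filter (fun V' => W ⊆ V'), (1 / ((U.filter (fun V' => W ⊆ V')).card : ℚ)) =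
        ∑ V ∈ U, ∑ W ∈ D.filter (fun W' => W' ⊆ V), (1 / ((U.filter (fun V' => W ⊆ V')).card : ℚ)) := by
      apply sum_comm'
      intro W V
      simp only [mem_filter]
      tauto
    have h3 : ∑ V ∈ U, ∑ W ∈ D.filter (fun W' => W' ⊆ V), (1 / ((U.filter (fun V' => W ⊆ V')).card : ℚ)) ≤
        ∑ V ∈ U, (1 : ℚ) := by
      apply sum_le_sum
      intro V hV
      rcases (D.filter (fun W' => W' ⊆ V)).eq_empty_or_nonempty with hemp | hne
      · rw [hemp, sum_empty]
        exact zero_le_one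
      · have hc : 0 < (D.filter (fun W' => W' ⊆ V)).card := card_pos.2 hne
        calc ∑ W ∈ D.filter (fun W' => W' ⊆ V), (1 / ((U.filter (fun V' => W ⊆ V')).card : ℚ))
            ≤ ∑ W ∈ D.filter (fun W' => W' ⊆ V), (1 / ((D.filter (fun W' => W' ⊆ V)).card : ℚ)) := by
              apply sum_le_sum
              intro W hW
              rw [mem_filter] at hW
              have h := hlym W hW.1 V hV hW.2
              have hs : (0 : ℚ) < (U.filter (fun V' => W ⊆ V')).card := by
                exact_mod_cast lt_of_lt_of_le hc h
              exact one_div_le_one_div_of_le (by exact_mod_cast hc) (by exact_mod_cast h)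
          _ = 1 := by
              rw [sum_const, nsmul_eq_mul, mul_one_div, div_self]
              exact_mod_cast hc.ne'
    rw [h1, h2]
    refine h3.trans ?_
    rw [sum_const, nsmul_eq_mul, mul_one]
  exact_mod_cast key

/-- Every demand of a class whose circuit captures `x` has a unit above it: a basis `J ⊇ W` of `E − x` minus a
point of `J ∖ W` (the construction of `gammaC_four_le_of_card_eq_four`, for a general class `C` with
`x ∈ cl C`). -/
theorem exists_unit_superset (hn : (gr N).card = rk N (gr N) + 4) (hR : 6 ≤ rk N (gr N)) {x : α}
    {C W : Finset α} (hW : W ∈ (biIndepSets N 4).filter (fun W => x ∉ W ∧ x ∈ clF N W ∧ fundC N W x = C))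
    (hxC : x ∈ clF N C) :
    ∃ V ∈ (biIndepSets N ((gr N).card - 5)).filter (fun V => x ∉ V ∧ x ∈ clF N V ∧ fundC N V x = C), W ⊆ V := by
  rw [mem_filter, mem_biIndepSets] at hW
  obtain ⟨⟨hWg, hWcard, hWrk, hWcompl⟩, hxW, hxcl, hfund⟩ := hW
  obtain ⟨J, hWJ, hJE, hJrk, hJcard⟩ := exists_indep_erase_superset_card_rk hWg hWrk hxW hxcl
  have hJg : J ⊆ gr N := hJE.trans (erase_subset _ _)
  have hxJ : x ∉ J := fun h => (mem_erase.1 (hJE h)).1 rfl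
  obtain ⟨u, huJ, huW⟩ := exists_mem_notMem_of_card_lt_card (show W.card < J.card by omega)
  have hWV : W ⊆ J.erase u := by
    intro w hw
    rw [mem_erase]
    exact ⟨fun h => huW (h ▸ hw), hWJ hw⟩
  have hVg : J.erase u ⊆ gr N := (erase_subset _ _).trans hJg
  have hVrk : rk N (J.erase u) = (J.erase u).card := rk_eq_card_of_subset_of_rk_eq_card (erase_subset _ _) hJrk
  have hxV : x ∉ J.erase u := fun h => hxJ (erase_subset _ _ h)
  have hxclV : x ∈ clF N (J.erase u) := mem_clF_of_subset hWV hxcl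
  refine ⟨J.erase u, ?_, hWV⟩
  rw [mem_filter, mem_biIndepSets]
  refine ⟨⟨hVg, ?_, hVrk, ?_⟩, hxV, hxclV, ?_⟩
  · rw [card_erase_of_mem huJ, hJcard]
    omega
  · exact rk_eq_card_of_subset_of_rk_eq_card (sdiff_subset_sdiff (Subset.refl _) hWV) hWcompl
  · exact fundC_eq_of_subset hWg hWrk hxcl hfund hxC hWV hVg hVrk hxclV

/-- THE CLASS `#C = 2` (`#(C ∪ x) = 3`, the core; §52(b), the `#D = 3` case): the LYM counting on the containment
graph of the class, with `local_lym_of_card_eq_two` on every edge. -/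
theorem gammaC_four_le_of_card_eq_two (hn : (gr N).card = rk N (gr N) + 4) (hR : 6 ≤ rk N (gr N))
    (x : α) {C : Finset α} (hC : C.card = 2) : gammaC N 4 x C ≤ gammaC N ((gr N).card - 5) x C := by
  unfold gammaC
  apply card_le_card_of_lym
  · intro W hW
    -- `x ∈ cl C`: the points of `W ∖ C` are not in the fundamental circuit
    have hW' := hW
    rw [mem_filter, mem_biIndepSets] at hW'
    obtain ⟨⟨hWg, hWcard, hWrk, hWcompl⟩, hxW, hxcl, hfund⟩ := hW'
    have hxg : x ∈ gr N := clF_subset_gr W hxcl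
    have hCW : C ⊆ W := hfund ▸ fundC_subset W x
    have hxC : x ∈ clF N C := by
      have h := mem_clF_sdiff_of_forall_notMem_fundC hxg hWg hWrk hxcl (W \ C) sdiff_subset
        (fun w hw => by rw [hfund]; exact (mem_sdiff.1 hw).2)
      rwa [Finset.sdiff_sdiff_eq_self hCW] at h
    exact exists_unit_superset hn hR hW hxC
  · intro W hW V hV hWV
    exact local_lym_of_card_eq_two hn hR x hC hW hV hWV

/-- The class `C = ∅` is empty: a captured set has a non-empty fundamental circuit (`x` is not a loop since
`x ∈ E ∖ W` is independent, and `mem_clF_sdiff_of_forall_notMem_fundC` with `S = W` would put `x` in `cl ∅`). -/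
theorem gammaC_eq_zero_of_card_eq_zero {k : ℕ} {x : α} {C : Finset α} (hC : C.card = 0) (_hk : 1 ≤ k)
    (hx : x ∈ gr N) : gammaC N k x C = 0 := by
  rw [card_eq_zero] at hC
  subst hC
  unfold gammaC
  rw [card_eq_zero, filter_eq_empty_iff]
  intro W hW hWx
  obtain ⟨hxW, hxcl, hfund⟩ := hWx
  rw [mem_biIndepSets] at hW
  obtain ⟨hWg, hWcard, hWrk, hWcompl⟩ := hW
  -- `x ∈ cl(W ∖ S)` for every `S ⊆ W`, by induction on `S` (submodularity on `(W ∖ S) + x` and `(W − w) + x`)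
  have hloop : x ∈ clF N ∅ := by
    have := mem_clF_sdiff_of_forall_notMem_fundC hx hWg hWrk hxcl W (Subset.refl W)
      (fun w _ => by rw [hfund]; exact notMem_empty w)
    rwa [sdiff_self] at this
  -- but `x ∈ E ∖ W`, which is independent: `x` is not a loop
  have hx1 : rk N {x} = 1 := by
    have h := rk_eq_card_of_subset_of_rk_eq_card (singleton_subset_iff.2 (mem_sdiff.2 ⟨hx, hxW⟩)) hWcompl
    rwa [card_singleton] at h
  have hx0 : rk N {x} = 0 := by
    have h := rk_insert_eq hx (empty_subset (gr N)) (M := N)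
    rw [if_pos hloop, insert_empty] at h
    rw [h]
    exact Nat.le_zero.1 ((rk_le_card (M := N) ∅).trans (by rw [card_empty]))
  omega

/-- **THE BOTTOM-LEVEL PER-CIRCUIT CLAIM AT NULLITY 4** (§52(b)): on a matroid with `#E = ρ(E) + 4` and `ρ(E) ≥ 6`,
every circuit class has at least as many captured sets at the level `n − 5` as at the level `4` — by cases on the
size of the class. -/
theorem gammaC_four_le_of_nullity_four (hn : (gr N).card = rk N (gr N) + 4) (hR : 6 ≤ rk N (gr N))
    (x : α) (C : Finset α) : gammaC N 4 x C ≤ gammaC N ((gr N).card - 5) x C := by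
  rcases Nat.lt_or_ge 4 C.card with h5 | h4
  · rw [gammaC_eq_zero_of_lt_card h5]
    exact Nat.zero_le _
  · by_cases hx : x ∈ gr N
    · interval_cases hc : C.card
      · rw [gammaC_eq_zero_of_card_eq_zero hc (by norm_num) hx]
        exact Nat.zero_le _
      · exact gammaC_four_le_of_card_eq_one hn hR x hc
      · exact gammaC_four_le_of_card_eq_two hn hR x hc
      · exact gammaC_four_le_of_card_eq_three hn hR x hc
      · exact gammaC_four_le_of_card_eq_four hn hR x hc
    · -- `x ∉ E`: no bi-independent set captures `x` (`clF` stays inside the ground set)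
      have h0 : gammaC N 4 x C = 0 := by
        unfold gammaC
        rw [card_eq_zero, filter_eq_empty_iff]
        intro W _ hWC
        exact hx (clF_subset_gr W hWC.2.1)
      rw [h0]
      exact Nat.zero_le _

/-- `κ_4(x) ≤ κ_{n−5}(x)` on every matroid of nullity `4` and rank `≥ 6` — the per-point form `(C_x)` of Theorem A
at the level `4`, summed over the circuit classes. -/
theorem capCount_four_le_of_nullity_four (hn : (gr N).card = rk N (gr N) + 4) (hR : 6 ≤ rk N (gr N))
    (x : α) : capCount N 4 x ≤ capCount N ((gr N).card - 5) x := by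
  rw [capCount_eq_sum_gammaC, capCount_eq_sum_gammaC]
  exact sum_le_sum (fun C _ => gammaC_four_le_of_nullity_four hn hR x C)

/-- `out_4(x) ≤ in_5(x)` on every matroid of nullity `4` and rank `≥ 6` (the mirror identity
`outCount_add_capCount_mirror` with `capCount_four_le_of_nullity_four`). -/
theorem outCount_four_le_inCount_five_of_nullity_four (hn : (gr N).card = rk N (gr N) + 4)
    (hR : 6 ≤ rk N (gr N)) {x : α} (hx : x ∈ gr N) : outCount N 4 x ≤ inCount N 5 x := by
  have h := outCount_add_capCount_mirror (M := N) 4 hx (by omega)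
  have h2 := capCount_four_le_of_nullity_four hn hR x
  norm_num at h
  omega

/-- **THEOREM A'S STEP AT THE LEVEL `4` ON EVERY MATROID OF NULLITY `4` AND RANK `≥ 6`**:
`(n − 4)·P_4 ≤ 5·P_5` — OPEN (2)'s nullity-4 sub-case (§46(a), §52). -/
theorem biIndep_step_four_of_nullity_four (hn : (gr N).card = rk N (gr N) + 4) (hR : 6 ≤ rk N (gr N)) :
    ((gr N).card - 4) * (biIndepSets N 4).card ≤ 5 * (biIndepSets N 5).card := by
  rw [← sum_outCount, ← sum_inCount]
  exact sum_le_sum (fun x hx => outCount_four_le_inCount_five_of_nullity_four hn hR hx)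

/-- `(I_{ρ−1})` at co-rank `5` on `#E = ρ(E) + 4` from the step alone (the body of
`thresholdIneq_of_card_eq_of_unimodal` with the single instance `biIndep_step_four_of_nullity_four`). -/
theorem thresholdIneq_five_top_of_card_eq (hn : (gr N).card = rk N (gr N) + 4) (hR : 6 ≤ rk N (gr N)) :
    ThresholdIneq N 5 (rk N (gr N) - 1) := by
  have hn' : (gr N).card = (rk N (gr N) - 1) + 5 := by omega
  unfold ThresholdIneq
  rw [thresholdSum_of_card_eq hn' (by norm_num), levelSetCoQ_eq_biIndepSets_of_card_eq hn']
  have h := biIndep_step_four_of_nullity_four hn hR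
  have e1 : (gr N).card - 4 = (rk N (gr N) - 1) + 1 := by omega
  rw [e1] at h
  exact h

/-- **THE CO-RANK-5 TOP THRESHOLD ON EVERY FINITE MATROID WITH AT MOST FOUR MORE POINTS THAN ITS RANK (RANK `≥ 5`),
UNCONDITIONALLY** — the unconditional form of `thresholdIneq_five_top_of_nullity_le_four_of_unimodal`: nullity
`≤ 3` is vacuous, rank `5` is the trivial row, nullity `4` at rank `≥ 6` is `biIndep_step_four_of_nullity_four`. -/
theorem thresholdIneq_five_top_of_nullity_le_four (hn : (gr N).card ≤ rk N (gr N) + 4) (hR : 5 ≤ rk N (gr N)) :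
    ThresholdIneq N 5 (rk N (gr N) - 1) := by
  by_cases hlow : (gr N).card + 2 ≤ rk N (gr N) + 5
  · exact thresholdIneq_top_of_card_add_two_le (by norm_num) hlow
  · by_cases hRq : rk N (gr N) = 5
    · exact thresholdIneq_top_of_rk_eq (by norm_num) hRq
    · exact thresholdIneq_five_top_of_card_eq (by omega) (by omega)

end Assembly

end PercRepro.Cogirth
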